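import Summits.FinalStateConjecture.FinalStateConjecture.Theorems.ChannelsResolveTameDevelopmentsR.Negative.SubMinkowski
import Literature.Geometry.Lorentzian.GeodesicMaximal
import HarnessLib

/-!
# Complete `𝓘⁺` pins the exterior: for the open sub-developments of Minkowski space, future null
# infinity is complete (sojourn form) IFF the whole closed future of the slice is present — support
# for the crux `ChannelsResolveTameDevelopmentsR` (K2R ≡ Φ, item `stmt-FinalStateConjecture-14075`,
# route PhotonSphereChannels), load-bearing analysis on the certifiable (flat) model class

Every open connected `U ⊆ ℝ⁴` containing the slice `{x⁰ = 0}` in which the slice is still a Cauchy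
hypersurface carries the vacuum Cauchy development `η|_U` of the trivial admissible datum
(`VacuumCauchyDevelopment.restrict`); these are ALL the certifiable models of Φ's carrier (the tree
constructs no development of a non-trivial datum). The Disproof of the crux records ON PAPER that of the
two structural hypotheses {`IsMaximal`, complete `𝓘⁺`} of Φ — jointly load-bearing by the slab
certificate `Negative/SlabMinkowski*` — maximality is idle GIVEN completeness, because a complete
development "contains the whole visible future". This file (with the tools of part 1, `Negative/SubMinkowski`) makes that a
theorem on the model class:

* `SubMinkowski.geodesic_affine` (part 1) — geodesics of `η|_U` are straight: `γ(t) = γ(0) + t γ'(0)` on their (interval)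
  domain (geodesic equations in the chart, vanishing Christoffel map);
* `SubMinkowski.false_of_line_mem_at_closure_point` (part 1) — a MAXIMAL geodesic of `η|_U` cannot have the point
  `γ(0) + c γ'(0)` in `U` at a finite end `c ∈ closure dom ∖ dom` of its domain (glue the straight
  line near `c`: a proper geodesic extension);
* `SubMinkowski.not_mem_of_spatial_lt` (part 1) — the MISSING FUTURE IS A FUTURE SET: if `q ∉ U`, `q⁰ ≥ 0`, then the whole
  open future cone `{x | ‖x̲ − q̲‖ < x⁰ − q⁰}` misses `U` (else the straight timelike line from `q`
  through such an `x`, cut to its connected piece inside `U`, is an endless timelike curve of `η|_U`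
  — `OpensCausality.not_hasFutureEndpoint_connectedComponentIn` — never meeting the slice,
  contradicting the Cauchy property);
* `not_hasCompleteNullInfinity_of_not_mem` — **a missing point above the slice makes `𝓘⁺`
  INCOMPLETE**: from slice points `y` arbitrarily far out, the maximal null geodesic aimed at `q̲`
  (O'Neill's `γ_v`, `exists_isMaximalGeodesicOn`) is a normalised null ray which is straight, leaves
  `U` before affine time `(‖q̲ − y‖ + q⁰ + 1)/2` (it enters the cone of `q`) and enters `J⁺(ι B₀)`,
  `B₀ ⊆ B̄(0, ρ)`, only after affine time `(‖y‖ − ρ)/2` (causal curves of `U` are causal curves of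
  `ℝ⁴`, which stay in the light cone): bounded domain, sojourn `≤ (‖q̲‖ + q⁰ + ρ + 1)/2` uniformly
  in `y`;
* `hasCompleteNullInfinity_of_future_subset` — conversely, if `{x⁰ ≥ 0} ⊆ U` every normalised null
  ray from the slice is future complete (it is straight with `(γ t)⁰ = t`, and a finite future end
  `b = sup dom > 0` would put `γ(0) + b γ'(0) ∈ {x⁰ > 0} ⊆ U`);
* `hasCompleteNullInfinity_iff_future_subset` — **`𝓘⁺` of `η|_U` is complete iff `{x⁰ ≥ 0} ⊆ U`.**

So on the flat class complete `𝓘⁺` alone forces the development to contain the entire visible future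
`J⁺(Σ)` of the MGHD candidate; the sequel `SubMinkowskiSettled` concludes that Φ with `IsMaximal`
deleted HOLDS on this class (maximality is idle there), complementing `not_tameResolution_allDevelopments`.

## References

* D. Christodoulou, CQG 16 (1999) A23, pp. A26–A27; M. Dafermos, I. Rodnianski, arXiv:0811.0354, §2.6.2
  (complete future null infinity, sojourn form).
* B. O'Neill, *Semi-Riemannian geometry* (1983), Ch. 3, Cor. 21, Prop. 24 (geodesics of `ℝⁿ₁`,
  maximal geodesics), Ch. 5, p. 145 and Ch. 14, p. 402 (causal cones), Def. 14.28 (Cauchy hypersurfaces).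
* J. Sbierski, AHP 17 (2016), §3.1 (curve pieces in open sub-spacetimes).
-/

noncomputable section

open Bundle Set Function Filter TopologicalSpace Topology MeasureTheory Metric
open scoped Manifold ContDiff Topology ENNReal

set_option linter.dupNamespace false

namespace Summit.FinalStateConjecture.FinalStateConjecture.Theorems.ChannelsResolveTameDevelopmentsR.SubMinkowski

open Literature.Geometry.Lorentzian Literature.Geometry.Lorentzian.Minkowski
open Summit.FinalStateConjecture.FinalStateConjecture.Theorems.WeakCosmicCensorshipMGHD.Negative
  (mdifferentiableAt_sliceNormal dirE3 norm_dirE3)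

/-! ### Causal curves of `η|_U` are causal curves of Minkowski space -/

section Causal

variable {U : Opens E4}


/-- **A curve in the open sub-spacetime `η|_U` is a future causal curve there iff it is one in Minkowski
space** (same velocity, same form and orienting field at the point; the causal companion of
`LorentzianMetric.isFutureTimelikeCurveOn_restrict_iff`). O'Neill 1983, Ch. 1, pp. 3–7. -/
theorem isFutureCausalCurveOn_restrict_iff {c : ℝ → U} {s : Set ℝ} :
    (subMetric U).IsFutureCausalCurveOn (subOrientation U) c s ↔
      spacetime.metric.IsFutureCausalCurveOn spacetime.timeOrientation (Subtype.val ∘ c) s := by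
  refine forall₂_congr fun t _ ↦ ?_
  have hv := velocity_subtypeVal_comp (I := 𝓘(ℝ, E4)) U c t
  change (MDifferentiableAt 𝓘(ℝ, ℝ) 𝓘(ℝ, E4) c t ∧
      (bilin (velocity 𝓘(ℝ, E4) c t) (velocity 𝓘(ℝ, E4) c t) ≤ 0 ∧ (velocity 𝓘(ℝ, E4) c t : E4) ≠ 0) ∧
        bilin (E4.basisVector 0) (velocity 𝓘(ℝ, E4) c t) < 0) ↔
    (MDifferentiableAt 𝓘(ℝ, ℝ) 𝓘(ℝ, E4) (Subtype.val ∘ c) t ∧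
      (bilin (velocity 𝓘(ℝ, E4) (Subtype.val ∘ c) t) (velocity 𝓘(ℝ, E4) (Subtype.val ∘ c) t) ≤ 0 ∧
          (velocity 𝓘(ℝ, E4) (Subtype.val ∘ c) t : E4) ≠ 0) ∧
        bilin (E4.basisVector 0) (velocity 𝓘(ℝ, E4) (Subtype.val ∘ c) t) < 0)
  rw [mdifferentiableAt_subtypeVal_comp_curve_iff, hv]
  exact Iff.rfl

/-- A future causal curve of `η|_U` is a future causal curve of Minkowski space. -/
theorem isFutureCausalCurveOn_subtypeVal_comp {c : ℝ → U} {s : Set ℝ}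
    (h : (subMetric U).IsFutureCausalCurveOn (subOrientation U) c s) :
    spacetime.metric.IsFutureCausalCurveOn spacetime.timeOrientation (Subtype.val ∘ c) s :=
  isFutureCausalCurveOn_restrict_iff.1 h

/-- **Causal futures of slice sets stay in the light cone.** If a point `z` of `η|_U` lies in the causal
future (within `U`) of the slice set `ι(B)`, `B ⊆ B̄(0, ρ)`, then `‖z̲‖ − ρ ≤ z⁰` — more precisely
`‖z̲ − p̲‖ ≤ z⁰` for some `p ∈ B` (causal curves of `U` are causal curves of `ℝ⁴`, which satisfy
`‖Δx̲‖ ≤ Δt`, `Minkowski.norm_spatial_sub_le_of_isFutureCausalCurveOn`). O'Neill 1983, Ch. 14, p. 402. -/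
theorem exists_norm_spatial_sub_le_of_mem_causalFuture {hsl : ∀ y : slice, sliceEmbed y ∈ U}
    {B : Set slice} {z : U}
    (hz : z ∈ (subMetric U).causalFuture (subOrientation U) (vacuumCauchyDevelopment.embedOpens U hsl '' B)) :
    ∃ p ∈ B, ‖E4.spatial (z : E4) - (p : E3)‖ ≤ (z : E4) 0 := by
  rcases hz with hz | ⟨_, ⟨p, hp, rfl⟩, c, a, b, hab, hc, hca, hcb⟩
  · obtain ⟨p, hp, hpz⟩ := hz
    refine ⟨p, hp, ?_⟩
    have hval : (z : E4) = E4.ofTimeSpace 0 (p : E3) := by rw [← hpz]; rfl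
    rw [hval, E4.spatial_ofTimeSpace, sub_self, norm_zero, E4.ofTimeSpace_apply_zero]
  · refine ⟨p, hp, ?_⟩
    have hcM := isFutureCausalCurveOn_subtypeVal_comp hc
    have h := norm_spatial_sub_le_of_isFutureCausalCurveOn ordConnected_Icc hcM (left_mem_Icc.2 hab.le)
      (right_mem_Icc.2 hab.le) hab.le
    have e1 : E4.spatial ((c a : U) : E4) = (p : E3) := by rw [hca]; exact E4.spatial_ofTimeSpace 0 _
    have e2 : ((c a : U) : E4) 0 = 0 := by rw [hca]; rfl
    have h2 : ‖E4.spatial ((c b : U) : E4) - E4.spatial ((c a : U) : E4)‖ ≤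
        ((c b : U) : E4) 0 - ((c a : U) : E4) 0 := h
    rw [e1, e2, sub_zero, hcb] at h2
    exact h2

end Causal

/-! ### A missing point above the slice makes `𝓘⁺` incomplete -/

section Complete

variable {U : Opens E4} {hU : IsConnected (U : Set E4)} {hsl : ∀ y : slice, sliceEmbed y ∈ U}
  {hC : (subMetric U).IsCauchyHypersurface (subOrientation U)
    (range (vacuumCauchyDevelopment.embedOpens U hsl))}

/-- **A MISSING POINT ON OR ABOVE THE SLICE MAKES FUTURE NULL INFINITY INCOMPLETE** (sojourn form).
Let `q ∉ U` with `q⁰ ≥ 0`. Given a candidate `B₀ ⊆ B̄(0, ρ)` take the threshold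
`s = (‖q̲‖ + q⁰ + ρ + 1)/2 + 1`; whatever compact `B₁` is exempted, pick a slice point `y ∉ B₁` with
`‖y‖ ≥ ‖q̲‖ + q⁰ + ρ + 2` and let `γ` be the maximal null geodesic of `η|_U` from `ι y` with velocity
`v = (1, e)`, `e = (q̲ − y)/‖q̲ − y‖` (`exists_isMaximalGeodesicOn`): a normalised null ray, straight
(`γ(t) = (t, y + t e)`, `geodesic_affine`). At affine time `s₁ = (‖q̲ − y‖ + q⁰ + 1)/2` the line is in the
open future cone of `q`, hence outside `U` (`not_mem_of_spatial_lt`), so `dom ⊆ (−∞, s₁)` is bounded;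
and a parameter `t ≥ 0` with `γ(t) ∈ J⁺(ι B₀)` has `‖y + t e − p‖ ≤ t` for some `‖p‖ ≤ ρ`
(`exists_norm_spatial_sub_le_of_mem_causalFuture`), i.e. `t ≥ (‖y‖ − ρ)/2`. So the sojourn of `γ` in
`J⁺(ι B₀)` is at most `s₁ − (‖y‖ − ρ)/2 ≤ (‖q̲‖ + q⁰ + ρ + 1)/2 < s`: neither alternative of completeness
holds. Christodoulou, CQG 16 (1999), pp. A26–A27; Dafermos–Rodnianski arXiv:0811.0354, §2.6.2. -/
theorem not_hasCompleteNullInfinity_of_not_mem {q : E4} (hq : q ∉ (U : Set E4)) (hq0 : 0 ≤ q 0) :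
    ¬ _root_.Summit.FinalStateConjecture.HasCompleteNullInfinity (subDev U hU hsl hC).toCauchyDevelopment := by
  intro h
  haveI hLC : (subDev U hU hsl hC).metric.HasLeviCivita := PseudoRiemannianMetric.hasLeviCivita _
  haveI hLC' : (subMetric U).toPseudoRiemannianMetric.HasLeviCivita := hLC
  haveI : CovariantDerivative.ContMDiffCovariantDerivative
      (subMetric U).toPseudoRiemannianMetric.leviCivita 1 :=
    ⟨(subMetric U).toPseudoRiemannianMetric.isLocallyContMDiff_leviCivita_holds 1
      (by rw [show ((1 : ℕ∞) : ℕ∞ω) + 1 = 2 by norm_num]; exact WithTop.coe_le_coe.2 le_top)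
      univ isOpen_univ⟩
  have h' : (subDev U hU hsl hC).metric.HasCompleteFutureNullInfinity (subDev U hU hsl hC).timeOrientation
      (subDev U hU hsl hC).embed (subDev U hU hsl hC).normal := h
  obtain ⟨B₀, hB₀, hB⟩ := h'
  -- the candidate base set is bounded
  obtain ⟨ρ, hρ0, hρ⟩ : ∃ ρ : ℝ, 0 ≤ ρ ∧ ∀ z ∈ B₀, ‖(z : E3)‖ ≤ ρ := by
    obtain ⟨R, hR⟩ := (Metric.isBounded_iff_subset_closedBall (0 : E3)).1
      (hB₀.image continuous_subtype_val).isBounded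
    refine ⟨|R|, abs_nonneg R, fun z hz ↦ ?_⟩
    have := hR ⟨z, hz, rfl⟩
    rw [Metric.mem_closedBall, dist_zero_right] at this
    exact this.trans (le_abs_self R)
  -- the threshold, and the exempted compact set
  set S : ℝ := (‖E4.spatial q‖ + q 0 + ρ + 1) / 2 + 1 with hS
  have hSpos : 0 < S := by positivity
  obtain ⟨B₁, hB₁, hrays⟩ := hB S hSpos
  obtain ⟨R₁, hR₁⟩ := (Metric.isBounded_iff_subset_closedBall (0 : E3)).1
    (hB₁.image continuous_subtype_val).isBounded
  -- a far slice point outside `B₁`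
  set R₀ : ℝ := ‖E4.spatial q‖ + q 0 + ρ + 2 with hR₀
  set r : ℝ := max R₀ |R₁| + 1 with hr
  have hr0 : 0 ≤ r := by
    have : 0 ≤ max R₀ |R₁| := (abs_nonneg R₁).trans (le_max_right _ _)
    linarith
  set y : slice := ⟨r • dirE3, mem_slice _⟩ with hy
  have hyn : ‖(y : E3)‖ = r := by
    show ‖r • dirE3‖ = r
    rw [norm_smul, norm_dirE3, mul_one, Real.norm_eq_abs, abs_of_nonneg hr0]
  have hyB₁ : y ∉ B₁ := fun hyB ↦ by
    have h1 := hR₁ ⟨y, hyB, rfl⟩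
    rw [Metric.mem_closedBall, dist_zero_right, hyn] at h1
    have : |R₁| < r := by
      have := le_max_right R₀ |R₁|; linarith
    linarith [le_abs_self R₁]
  have hyR : R₀ ≤ ‖(y : E3)‖ := by rw [hyn]; have := le_max_left R₀ |R₁|; linarith
  -- the aiming direction and the null velocity `v = (1, e)`
  set d : E3 := E4.spatial q - (y : E3) with hd
  set L : ℝ := ‖d‖ with hL
  have hLge : ‖(y : E3)‖ - ‖E4.spatial q‖ ≤ L := by
    rw [hL, hd, norm_sub_rev]
    exact norm_sub_norm_le _ _
  have hLle : L ≤ ‖E4.spatial q‖ + ‖(y : E3)‖ := norm_sub_le _ _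
  have hL2 : q 0 + ρ + 2 ≤ L := by linarith
  have hLpos : 0 < L := by linarith
  set e : E3 := L⁻¹ • d with he
  have hen : ‖e‖ = 1 := by
    rw [he, norm_smul, norm_inv, Real.norm_eq_abs, abs_of_pos hLpos, ← hL, inv_mul_cancel₀ hLpos.ne']
  have hLe : L • e = d := by rw [he, smul_smul, mul_inv_cancel₀ hLpos.ne', one_smul]
  set v : E4 := E4.ofTimeSpace 1 e with hv
  have hv0 : v 0 = 1 := E4.ofTimeSpace_apply_zero 1 e
  have hvs : E4.spatial v = e := E4.spatial_ofTimeSpace 1 e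
  have hvnull : bilin v v = 0 := by
    rw [C0Extension.bilin_self_eq, hvs, hen, hv0]; norm_num
  have hvne : v ≠ 0 := fun h0 ↦ by
    have := congrArg (fun u : E4 ↦ u 0) h0
    rw [hv0] at this
    simp at this
  have hve₀ : bilin (E4.basisVector 0) v = -1 := by rw [bilin_basisVector_zero_left, hv0]
  -- the maximal null geodesic of `η|_U` from `ι y` with velocity `v`
  set p₀ : U := vacuumCauchyDevelopment.embedOpens U hsl y with hp₀
  have hp₀val : (p₀ : E4) = E4.ofTimeSpace 0 (y : E3) := rfl
  obtain ⟨γ, dom, hmax, h0, hγ0, hvel, -⟩ :=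
    exists_isMaximalGeodesicOn (cov := (subMetric U).toPseudoRiemannianMetric.leviCivita) p₀ v
  -- it is a normalised future null ray of the sub-development from `y`
  have hray : (subDev U hU hsl hC).metric.IsNormalisedNullRayFrom (subDev U hU hsl hC).timeOrientation
      (subDev U hU hsl hC).embed (subDev U hU hsl hC).normal y γ dom := by
    refine ⟨hmax, h0, hγ0, ?_, ?_, ?_⟩
    · change bilin (velocity 𝓘(ℝ, E4) γ 0) (velocity 𝓘(ℝ, E4) γ 0) = 0 ∧ velocity 𝓘(ℝ, E4) γ 0 ≠ 0
      rw [hvel]; exact ⟨hvnull, hvne⟩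
    · change (bilin (velocity 𝓘(ℝ, E4) γ 0) (velocity 𝓘(ℝ, E4) γ 0) ≤ 0 ∧ velocity 𝓘(ℝ, E4) γ 0 ≠ 0) ∧
        bilin (E4.basisVector 0) (velocity 𝓘(ℝ, E4) γ 0) < 0
      rw [hvel, hve₀]; exact ⟨⟨hvnull.le, hvne⟩, by norm_num⟩
    · change bilin (velocity 𝓘(ℝ, E4) γ 0) (E4.basisVector 0) = -1
      rw [hvel, bilin_symm, hve₀]
  -- it is straight
  obtain ⟨v', hv', -, hline⟩ := geodesic_affine hmax.isGeodesicOn hmax.isOpen hmax.2.1 h0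
  have hvv : v' = v := hv'.symm.trans hvel
  have hlineE : ∀ t ∈ dom, (γ t : E4) = E4.ofTimeSpace 0 (y : E3) + t • v := fun t ht ↦ by
    rw [hline t ht, hγ0, hp₀val, hvv]
  -- the exit parameter `s₁`: there the line is in the open future cone of `q`, hence outside `U`
  set s₁ : ℝ := (L + q 0 + 1) / 2 with hs₁
  have hs₁pos : 0 < s₁ := by rw [hs₁]; linarith
  have hs₁L : s₁ ≤ L := by rw [hs₁]; linarith
  have hcone : ‖E4.spatial (E4.ofTimeSpace 0 (y : E3) + s₁ • v) - E4.spatial q‖ <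
      (E4.ofTimeSpace 0 (y : E3) + s₁ • v) 0 - q 0 := by
    have hsp : E4.spatial (E4.ofTimeSpace 0 (y : E3) + s₁ • v) - E4.spatial q = (s₁ - L) • e := by
      rw [map_add, map_smul, E4.spatial_ofTimeSpace, hvs, sub_smul, hLe, hd]
      abel
    have ht : (E4.ofTimeSpace 0 (y : E3) + s₁ • v) 0 = s₁ := by
      simp [hv0]
    rw [hsp, ht, norm_smul, hen, mul_one, Real.norm_eq_abs, abs_of_nonpos (by linarith)]
    linarith
  have hexit : E4.ofTimeSpace 0 (y : E3) + s₁ • v ∉ (U : Set E4) := not_mem_of_spatial_lt hC hq hq0 hcone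
  have hs₁dom : s₁ ∉ dom := fun hs ↦ hexit (by rw [← hlineE s₁ hs]; exact (γ s₁).2)
  have hdomlt : ∀ t ∈ dom, t < s₁ := fun t ht ↦
    lt_of_not_ge fun hge ↦ hs₁dom (hmax.2.1.out h0 ht ⟨hs₁pos.le, hge⟩)
  have hbdd : BddAbove dom := ⟨s₁, fun t ht ↦ (hdomlt t ht).le⟩
  rcases hrays y hyB₁ γ dom hray with hunb | hsoj
  · exact hunb hbdd
  · -- the sojourn in `J⁺(ι B₀)` starts after `s₀ = (‖y‖ − ρ)/2` and ends before `s₁`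
    set s₀ : ℝ := (‖(y : E3)‖ - ρ) / 2 with hs₀
    have hkey : ∀ t ∈ dom, 0 ≤ t →
        γ t ∈ (subDev U hU hsl hC).metric.causalFuture (subDev U hU hsl hC).timeOrientation
          ((subDev U hU hsl hC).embed '' B₀) → s₀ ≤ t := by
      intro t ht ht0 hz
      obtain ⟨p, hp, hle⟩ := exists_norm_spatial_sub_le_of_mem_causalFuture (hsl := hsl) hz
      rw [hlineE t ht, map_add, map_smul, E4.spatial_ofTimeSpace, hvs] at hle
      have htime : (E4.ofTimeSpace 0 (y : E3) + t • v) 0 = t := by simp [hv0]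
      rw [htime] at hle
      have hpn : ‖(p : E3)‖ ≤ ρ := hρ p hp
      -- `‖y‖ − t − ρ ≤ ‖y + t e − p‖ ≤ t`
      have h1 : ‖(y : E3)‖ - ‖t • e‖ - ‖(p : E3)‖ ≤ ‖(y : E3) + t • e - (p : E3)‖ := by
        have := norm_sub_norm_le ((y : E3) + t • e) (p : E3)
        have h' := norm_le_norm_add_norm_sub' (y : E3) (t • e)
        have h'' : ‖(y : E3)‖ - ‖t • e‖ ≤ ‖(y : E3) + t • e‖ := by
          have := norm_sub_norm_le (y : E3) (-(t • e))
          rw [sub_neg_eq_add, norm_neg] at this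
          linarith [abs_le.1 (abs_norm_sub_norm_le (y : E3) (-(t • e)))]
        linarith
      have h2 : ‖t • e‖ = t := by rw [norm_smul, hen, mul_one, Real.norm_eq_abs, abs_of_nonneg ht0]
      rw [h2] at h1
      rw [hs₀]
      linarith
    have hsub : {t ∈ dom | 0 ≤ t ∧ γ t ∈ (subDev U hU hsl hC).metric.causalFuture
        (subDev U hU hsl hC).timeOrientation ((subDev U hU hsl hC).embed '' B₀)} ⊆ Icc s₀ s₁ :=
      fun t ht ↦ ⟨hkey t ht.1 ht.2.1 ht.2.2, (hdomlt t ht.1).le⟩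
    have hle : ENNReal.ofReal S ≤ volume (Icc s₀ s₁) := hsoj.trans (measure_mono hsub)
    rw [Real.volume_Icc] at hle
    have hS' : s₁ - s₀ ≤ S - 1 := by
      rw [hs₁, hs₀, hS]
      linarith
    rcases (ENNReal.ofReal_le_ofReal_iff' ).1 hle with h1 | h1
    · linarith
    · linarith

/-! ### Conversely: the whole future present makes `𝓘⁺` complete -/

/-- **If `U` contains the closed future half-space `{x⁰ ≥ 0}` then `𝓘⁺` of `η|_U` is complete**: every
normalised null ray `γ` from the slice is straight with `(γ t)⁰ = t` (`geodesic_affine`, normalisation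
`η(γ'(0), ∂ₜ) = −1`), so a finite future end `b = sup dom > 0` of its affine domain would put the line point
`γ(0) + b γ'(0)`, of time `b ≥ 0`, in `U` — impossible for a maximal geodesic
(`false_of_line_mem_at_closure_point`). Hence every ray is future complete (first alternative of the
sojourn form, `hasCompleteFutureNullInfinity_of_forall_not_bddAbove`). Christodoulou, CQG 16 (1999), p. A27. -/
theorem hasCompleteNullInfinity_of_future_subset (hfut : {x : E4 | 0 ≤ x 0} ⊆ (U : Set E4)) :
    _root_.Summit.FinalStateConjecture.HasCompleteNullInfinity (subDev U hU hsl hC).toCauchyDevelopment := by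
  intro hLC
  haveI : (subMetric U).toPseudoRiemannianMetric.HasLeviCivita := hLC
  refine LorentzianMetric.hasCompleteFutureNullInfinity_of_forall_not_bddAbove fun y γ dom hray hbdd ↦ ?_
  -- view the ray as a curve of the open submanifold `U`
  change ℝ → U at γ
  obtain ⟨hmax, h0, hγ0, -, -, hnorm⟩ := hray
  change IsMaximalGeodesicOn (subMetric U).toPseudoRiemannianMetric.leviCivita γ dom at hmax
  obtain ⟨v, hv, -, -⟩ := geodesic_affine hmax.isGeodesicOn hmax.isOpen hmax.2.1 h0
  -- normalisation: `v⁰ = 1`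
  have hv0 : v 0 = 1 := by
    have h' : bilin (velocity 𝓘(ℝ, E4) γ 0) (E4.basisVector 0) = -1 := hnorm
    rw [hv, bilin_symm, bilin_basisVector_zero_left] at h'
    linarith
  -- the future end `b = sup dom` is a positive closure point outside `dom`
  have hne : dom.Nonempty := ⟨0, h0⟩
  set b : ℝ := sSup dom with hb
  obtain ⟨ε, hε, hball⟩ := Metric.mem_nhds_iff.1 (hmax.isOpen.mem_nhds h0)
  have hεdom : ε / 2 ∈ dom := hball (by
    rw [Metric.mem_ball, Real.dist_eq, sub_zero, abs_of_pos (half_pos hε)]; exact half_lt_self hε)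
  have hbpos : 0 < b := (half_pos hε).trans_le (le_csSup hbdd hεdom)
  have hbcl : b ∈ closure dom := csSup_mem_closure hne hbdd
  have hbn : b ∉ dom := fun hbd ↦ by
    obtain ⟨ε', hε', hball'⟩ := Metric.mem_nhds_iff.1 (hmax.isOpen.mem_nhds hbd)
    have h1 : b + ε' / 2 ∈ dom := hball' (by
      rw [Metric.mem_ball, Real.dist_eq, add_sub_cancel_left, abs_of_pos (half_pos hε')]
      exact half_lt_self hε')
    have := le_csSup hbdd h1
    linarith
  -- the line point at `b` has time `b ≥ 0`, hence lies in `U`: impossible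
  have hmem : (γ 0 : E4) + b • v ∈ (U : Set E4) := by
    refine hfut ?_
    show 0 ≤ ((γ 0 : E4) + b • v) 0
    have h00 : (γ 0 : E4) 0 = 0 := by rw [hγ0]; rfl
    have : ((γ 0 : E4) + b • v) 0 = (γ 0 : E4) 0 + b * v 0 := by simp
    rw [this, h00, hv0]
    linarith
  exact false_of_line_mem_at_closure_point hmax h0 hv hbcl hbn hmem

/-- **COMPLETE `𝓘⁺` ⟺ THE WHOLE FUTURE IS PRESENT.** For the open sub-development `η|_U` of the trivial
datum (any open connected `U ⊇ {x⁰ = 0}` in which the slice is a Cauchy hypersurface), future null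
infinity is complete in Christodoulou's sojourn sense if and only if `U` contains the entire closed
future half-space `{x⁰ ≥ 0} = J⁺(Σ)` of Minkowski space. In particular a sojourn-complete sub-development
misses NO point visible from infinity, and differs from the maximal candidate `(ℝ⁴, η)` only to the past of
the slice — the certified form, on the flat model class, of "`IsMaximal` is idle given complete `𝓘⁺`".
[cite: Christodoulou1999, pp. A26–A27] -/
theorem hasCompleteNullInfinity_iff_future_subset :
    _root_.Summit.FinalStateConjecture.HasCompleteNullInfinity (subDev U hU hsl hC).toCauchyDevelopment ↔
      {x : E4 | 0 ≤ x 0} ⊆ (U : Set E4) :=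
  ⟨fun h _ hx ↦ by_contra fun hxU ↦ not_hasCompleteNullInfinity_of_not_mem (hC := hC) hxU hx h,
    hasCompleteNullInfinity_of_future_subset⟩

end Complete

end Summit.FinalStateConjecture.FinalStateConjecture.Theorems.ChannelsResolveTameDevelopmentsR.SubMinkowski

end
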